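import Summits.CriticalPhenomena.PercolationContinuityZ3.Theorems.PercNearOneGluingNoHeavyLowerTailSahiCoSunflowerAtomCovering
import Summits.CriticalPhenomena.PercolationContinuityZ3.Theorems.PercNearOneGluingNoHeavyLowerTailSahiStrongCubicPlus
import Mathlib.Tactic.Linarith
import Mathlib.Tactic.Ring
import Mathlib.Tactic.Positivity
import HarnessLib

/-!
# `NoHeavyLowerTail` (crux stmt-CriticalPhenomena-4575), master-family line P1 (gen 16):
# THEOREM — the ONE-PAYER inequality `e₃ ≤ max(κ,o)·(κo − e₂)` (S₃^max), hence S₃⁺ and S₃, on every ATOM-COVERING co-sunflower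

Support file (seat `prim-masterthm-p1`, gen 16; `--supports stmt-CriticalPhenomena-4575`).  Pure proof file (no definitions), no
`sorry`, standard axioms.  Memo `run/shared/lean/prim/prim-masterthm/FROM-prim-masterthm-p1-g16-ONE-PAYER.md` §6(3).

SETTING (tree `SahiDeepCore`).  Cells of a sandwiched triple `(A,B,N)`: petals `α, β, d`, core `κ`, outside `o`; `e₂ = αβ+αd+βd`,
`e₃ = αβd`, Gladkov's defect `G = κo − e₂ ≥ 0` (`gladkov_cells`).  The co-sunflower `(G₂∪G₃, G₁∪G₃, G₁∪G₂)` of three increasing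
events is sandwiched (petals "only `G_i`", core "≥ 2 occur", outside "none").  Gen 16's conjecture S₃^max (sibling file
`…SahiStrongCubicMax`, typed `StrongCubicMaxNonneg`): `max(κ,o)·G ≥ e₃` — "the heavier of core and outside pays for all
rainbows" — stronger than S₃⁺ `(κ+o)G ≥ e₃` ⟹ S₃ `G ≥ e₃` ⟹ the class law `(1+o)G ≥ e₃`.

NEW HERE (all [this work]):
1. `maxCells_antitone` — the MASS-TRANSFER principle for the max-side functional: at fixed outside mass `o ≥ 0`, if `G ≥ 0` at
   the lighter petal masses, then enlarging the petal masses never increases `max(κ,o)·G − e₃` (`κ = 1−o−α−β−d` shrinks, `G`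
   shrinks, `e₃` grows) — the analogue of gen 13's `classPsi_antitone` / `strongCubic_mono_petals`.
2. **THEOREM `coSunflower_maxSide_nonneg_of_atomCovering`.**  For increasing `G₁, G₂, G₃` on the finite cube with a product weight
   such that `∅ ∉ G_i` and every singleton configuration lies in `G₁ ∪ G₂ ∪ G₃`:
   `max(κ,o)·(κo − e₂) − e₃ ≥ 0` for the cells of the co-sunflower.  PROOF: as in gen 13 (`coSunflower_ge_of_atomCovering`) the
   outside is `{∅}` (mass `Q = Q₀Q₁Q₂`, `Q_i` = product of `1 − p_u` over the atom group of `G_i`) and the petal "only `G_i`" is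
   contained in "no coordinate of the other two groups present, `S ≠ ∅`" (mass `Q_jQ_k − Q`); by transfer the functional is at
   least its value at these envelope masses — the cells of the co-sunflower of the three independent OR-events of the groups
   (std3 ∘ OR-blocks) — where **the outside pays EXACTLY**: `e₃ = o·G` (`ring`), so the value is `(max(κ,o) − o)·G ≥ 0` with
   `G = Q(1−Q₀)(1−Q₁)(1−Q₂)`.  This is the first stratum on which the one-payer conjecture is a theorem beyond 3-block composites.
3. COROLLARIES `coSunflower_strongCubicPlus_nonneg_of_atomCovering` (S₃⁺ on the stratum) and
   `coSunflower_strongCubic_nonneg_of_atomCovering` (S₃ on the stratum; gen 13 had only the class law `E₃ ≥ 0` here).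
-/

noncomputable section

open scoped Classical

namespace Summit.CriticalPhenomena.PercolationContinuityZ3.Theorems

namespace SahiDeepCore

open Finset
open Literature.Combinatorics.Sahi2008
open Literature.Probability.LatticeModels (prodBernoulli prodBernoulli_real_forall_notMem)
open Literature.Probability.Percolation.DecisionTree (ind ind_of_mem ind_of_not_mem ind_nonneg)

variable {ι : Type} [Fintype ι]

local notation3 (prettyPrint := false) "m⟦" p ", " X "⟧" => ex (bernoulliWeight p) (ind X)

/-! ### 1. The max-side functional in outside/petal masses and its transfer principle -/

/-- **Transfer principle for the max-side functional** (pure real-variable statement).  With `κ = 1−o−α−β−d`,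
`G = κo − (αβ+αd+βd)`: if `0 ≤ o`, `0 ≤ α ≤ α'`, `0 ≤ β ≤ β'`, `0 ≤ d ≤ d'` and `0 ≤ G(α,β,d)`, then
`max(κ',o)·G(α',β',d') − α'β'd' ≤ max(κ,o)·G(α,β,d) − αβd`. [this work] -/
theorem maxCells_antitone {o α β d α' β' d' : ℝ} (ho : 0 ≤ o) (hα : 0 ≤ α) (hβ : 0 ≤ β) (hd : 0 ≤ d)
    (hαα : α ≤ α') (hββ : β ≤ β') (hdd : d ≤ d')
    (hG : 0 ≤ (1 - o - α - β - d) * o - (α * β + α * d + β * d)) :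
    max (1 - o - α' - β' - d') o * ((1 - o - α' - β' - d') * o - (α' * β' + α' * d' + β' * d')) - α' * β' * d'
      ≤ max (1 - o - α - β - d) o * ((1 - o - α - β - d) * o - (α * β + α * d + β * d)) - α * β * d := by
  set G := (1 - o - α - β - d) * o - (α * β + α * d + β * d) with hGdef
  set G' := (1 - o - α' - β' - d') * o - (α' * β' + α' * d' + β' * d') with hG'def
  have hα' : 0 ≤ α' := le_trans hα hαα
  have hβ' : 0 ≤ β' := le_trans hβ hββ
  have hd' : 0 ≤ d' := le_trans hd hdd
  -- G' ≤ G
  have hGG : G' ≤ G := by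
    have : G - G' = (α' - α + (β' - β) + (d' - d)) * o
        + (α' * β' - α * β) + (α' * d' - α * d) + (β' * d' - β * d) := by
      simp only [hGdef, hG'def]; ring
    have h1 : α * β ≤ α' * β' := mul_le_mul hαα hββ hβ hα'
    have h2 : α * d ≤ α' * d' := mul_le_mul hαα hdd hd hα'
    have h3 : β * d ≤ β' * d' := mul_le_mul hββ hdd hd hβ'
    nlinarith
  -- e₃ ≤ e₃'
  have he : α * β * d ≤ α' * β' * d' :=
    mul_le_mul (mul_le_mul hαα hββ hβ hα') hdd hd (mul_nonneg hα' hβ')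
  -- max(κ',o) ≤ max(κ,o), and both are ≥ 0
  have hmax : max (1 - o - α' - β' - d') o ≤ max (1 - o - α - β - d) o :=
    max_le_max (by linarith) le_rfl
  have hmax0 : 0 ≤ max (1 - o - α' - β' - d') o := le_trans ho (le_max_right _ _)
  have step1 : max (1 - o - α' - β' - d') o * G' ≤ max (1 - o - α' - β' - d') o * G :=
    mul_le_mul_of_nonneg_left hGG hmax0
  have step2 : max (1 - o - α' - β' - d') o * G ≤ max (1 - o - α - β - d) o * G :=
    mul_le_mul_of_nonneg_right hmax hG
  linarith

/-! ### 2. Plumbing: monotonicity of the product weight (local copies) -/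

/-- `0 ≤ μ_p(X)`. [folklore] -/
private theorem massAC_nonneg (p : ι → unitInterval) (X : Set (Set ι)) : 0 ≤ m⟦p, X⟧ :=
  ex_nonneg (isFKGMeasure_bernoulliWeight p).nonneg fun ω => ind_nonneg _ ω

/-- `μ_p(Y ∖ X) = μ_p(Y) − μ_p(X)` for `X ⊆ Y`. [folklore] -/
private theorem massAC_sdiff (p : ι → unitInterval) {X Y : Set (Set ι)} (h : X ⊆ Y) :
    m⟦p, Y \ X⟧ = m⟦p, Y⟧ - m⟦p, X⟧ := by
  have e : ind Y = ind X + ind (Y \ X) := by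
    funext ω
    simp only [Pi.add_apply]
    by_cases hx : ω ∈ X
    · rw [ind_of_mem (h hx), ind_of_mem hx, ind_of_not_mem (fun hh : ω ∈ Y \ X => hh.2 hx), add_zero]
    · by_cases hy : ω ∈ Y
      · rw [ind_of_mem hy, ind_of_not_mem hx, ind_of_mem (show ω ∈ Y \ X from ⟨hy, hx⟩), zero_add]
      · rw [ind_of_not_mem hy, ind_of_not_mem hx, ind_of_not_mem (fun hh : ω ∈ Y \ X => hy hh.1), add_zero]
  have := congrArg (ex (bernoulliWeight p)) e
  rw [ex_add] at this
  linarith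

/-- Monotonicity of `μ_p`. [folklore] -/
private theorem massAC_mono (p : ι → unitInterval) {X Y : Set (Set ι)} (h : X ⊆ Y) : m⟦p, X⟧ ≤ m⟦p, Y⟧ := by
  have := massAC_sdiff p h
  have h0 := massAC_nonneg p (Y \ X)
  linarith

/-! ### 3. The one-payer inequality on the atom-covering stratum -/

/-- **THEOREM (S₃^max on every atom-covering co-sunflower).**  Let `G₁, G₂, G₃` be increasing events of the finite cube with a
product weight such that `∅ ∉ G_i` and every singleton configuration lies in `G₁ ∪ G₂ ∪ G₃`.  Then, for the cells of the
co-sunflower `(A,B,N) = (G₂∪G₃, G₁∪G₃, G₁∪G₂)`,  `max(κ, o)·(κ·o − (αβ+αd+βd)) − αβd ≥ 0`: the heavier of core and outside pays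
for all rainbows.  (Proof: transfer to the envelope masses of the OR-block composite of the standard system, where the outside pays
exactly.) [this work] -/
theorem coSunflower_maxSide_nonneg_of_atomCovering (p : ι → unitInterval) {G₁ G₂ G₃ : Set (Set ι)} (h₁ : IsUpperSet G₁)
    (h₂ : IsUpperSet G₂) (h₃ : IsUpperSet G₃) (hcov : ∀ u : ι, ({u} : Set ι) ∈ G₁ ∪ G₂ ∪ G₃)
    (h0 : (∅ : Set ι) ∉ G₁ ∪ G₂ ∪ G₃) :
    0 ≤ max (m⟦p, (G₂ ∪ G₃) ∩ (G₁ ∪ G₃) ∩ (G₁ ∪ G₂)⟧) (m⟦p, ((G₂ ∪ G₃) ∪ (G₁ ∪ G₃))ᶜ⟧) *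
          (m⟦p, (G₂ ∪ G₃) ∩ (G₁ ∪ G₃) ∩ (G₁ ∪ G₂)⟧ * m⟦p, ((G₂ ∪ G₃) ∪ (G₁ ∪ G₃))ᶜ⟧
            - (m⟦p, (G₂ ∪ G₃) \ (G₁ ∪ G₃)⟧ * m⟦p, (G₁ ∪ G₃) \ (G₂ ∪ G₃)⟧
                + m⟦p, (G₂ ∪ G₃) \ (G₁ ∪ G₃)⟧ * m⟦p, ((G₂ ∪ G₃) ∩ (G₁ ∪ G₃)) \ (G₁ ∪ G₂)⟧
                + m⟦p, (G₁ ∪ G₃) \ (G₂ ∪ G₃)⟧ * m⟦p, ((G₂ ∪ G₃) ∩ (G₁ ∪ G₃)) \ (G₁ ∪ G₂)⟧))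
        - m⟦p, (G₂ ∪ G₃) \ (G₁ ∪ G₃)⟧ * m⟦p, (G₁ ∪ G₃) \ (G₂ ∪ G₃)⟧ * m⟦p, ((G₂ ∪ G₃) ∩ (G₁ ∪ G₃)) \ (G₁ ∪ G₂)⟧ := by
  obtain ⟨s1, s2, s3⟩ := coSunflower_sandwich G₁ G₂ G₃
  obtain ⟨e3, e2, e1⟩ := coSunflower_privateParts G₁ G₂ G₃
  obtain ⟨d01, d02, d12, hcover⟩ := grp_disjoint_cover (G₁ := G₁) (G₂ := G₂) (G₃ := G₃) hcov
  have hm := mem_grp G₁ G₂ G₃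
  have h01 : (∅ : Set ι) ∉ G₁ := fun h => h0 (Or.inl (Or.inl h))
  have h02 : (∅ : Set ι) ∉ G₂ := fun h => h0 (Or.inl (Or.inr h))
  have h03 : (∅ : Set ι) ∉ G₃ := fun h => h0 (Or.inr h)
  set A := G₂ ∪ G₃ with hAdef
  set B := G₁ ∪ G₃ with hBdef
  set N := G₁ ∪ G₂ with hNdef
  set P0 := grpA G₁
  set P1 := grpB G₁ G₂
  set P2 := grpC G₁ G₂ G₃
  set Q0 := ∏ u ∈ P0, (1 - (p u : ℝ))
  set Q1 := ∏ u ∈ P1, (1 - (p u : ℝ))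
  set Q2 := ∏ u ∈ P2, (1 - (p u : ℝ))
  -- outside = {∅}
  have hout : (A ∪ B)ᶜ = avoid (Finset.univ : Finset ι) := by
    rw [avoid_univ_eq]
    ext S
    simp only [hAdef, hBdef, Set.mem_compl_iff, Set.mem_union, not_or, Set.mem_singleton_iff]
    constructor
    · rintro ⟨⟨hS2, hS3⟩, hS1, -⟩
      by_contra hne
      obtain ⟨u, hu⟩ := Set.nonempty_iff_ne_empty.2 hne
      have hsub : ({u} : Set ι) ≤ S := Set.singleton_subset_iff.2 hu
      rcases hcov u with (h | h) | h
      · exact hS1 (h₁ hsub h)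
      · exact hS2 (h₂ hsub h)
      · exact hS3 (h₃ hsub h)
    · rintro rfl
      exact ⟨⟨h02, h03⟩, h01, h03⟩
  have hprod_univ : ∏ u ∈ (Finset.univ : Finset ι), (1 - (p u : ℝ)) = Q0 * Q1 * Q2 := by
    rw [← hcover, Finset.prod_union (Finset.disjoint_union_left.2 ⟨d02, d12⟩), Finset.prod_union d01]
  have ho : m⟦p, (A ∪ B)ᶜ⟧ = Q0 * Q1 * Q2 := by rw [hout, m_avoid, hprod_univ]
  -- petal envelopes
  have pet1 : A \ B ⊆ avoid (P0 ∪ P2) \ avoid Finset.univ := by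
    rw [hAdef, hBdef, e2]
    intro S hS
    have hS2 : S ∈ G₂ := hS.1
    have hS1 : S ∉ G₁ := fun h => hS.2 (Or.inl h)
    have hS3 : S ∉ G₃ := fun h => hS.2 (Or.inr h)
    refine ⟨?_, ?_⟩
    · intro u hu huS
      have hsub : ({u} : Set ι) ≤ S := Set.singleton_subset_iff.2 huS
      rcases Finset.mem_union.1 hu with h | h
      · exact hS1 (h₁ hsub ((hm u).1.1 h))
      · exact hS3 (h₃ hsub ((hm u).2.2.1 h).1)
    · intro hav
      rw [avoid_univ_eq, Set.mem_singleton_iff] at hav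
      exact h02 (hav ▸ hS2)
  have pet2 : B \ A ⊆ avoid (P1 ∪ P2) \ avoid Finset.univ := by
    rw [hAdef, hBdef, e1]
    exact only_subset_avoid h₂ h₃ h01
  have pet3 : (A ∩ B) \ N ⊆ avoid (P0 ∪ P1) \ avoid Finset.univ := by
    rw [hAdef, hBdef, hNdef, e3]
    intro S hS
    have hS3 : S ∈ G₃ := hS.1
    have hS1 : S ∉ G₁ := fun h => hS.2 (Or.inl h)
    have hS2 : S ∉ G₂ := fun h => hS.2 (Or.inr h)
    refine ⟨?_, ?_⟩
    · intro u hu huS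
      have hsub : ({u} : Set ι) ≤ S := Set.singleton_subset_iff.2 huS
      rcases Finset.mem_union.1 hu with h | h
      · exact hS1 (h₁ hsub ((hm u).1.1 h))
      · exact hS2 (h₂ hsub ((hm u).2.1.1 h).1)
    · intro hav
      rw [avoid_univ_eq, Set.mem_singleton_iff] at hav
      exact h03 (hav ▸ hS3)
  have hsubU : ∀ R : Finset ι, avoid Finset.univ ⊆ avoid R := fun R => avoid_mono (Finset.subset_univ R)
  have env : ∀ R : Finset ι, m⟦p, avoid R \ avoid Finset.univ⟧ = (∏ u ∈ R, (1 - (p u : ℝ))) - Q0 * Q1 * Q2 := by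
    intro R; rw [massAC_sdiff p (hsubU R), m_avoid, m_avoid, hprod_univ]
  have hα : m⟦p, A \ B⟧ ≤ Q0 * Q2 - Q0 * Q1 * Q2 := by
    refine le_trans (massAC_mono p pet1) ?_
    rw [env, Finset.prod_union d02]
  have hβ : m⟦p, B \ A⟧ ≤ Q1 * Q2 - Q0 * Q1 * Q2 := by
    refine le_trans (massAC_mono p pet2) ?_
    rw [env, Finset.prod_union d12]
  have hd : m⟦p, (A ∩ B) \ N⟧ ≤ Q0 * Q1 - Q0 * Q1 * Q2 := by
    refine le_trans (massAC_mono p pet3) ?_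
    rw [env, Finset.prod_union d01]
  -- core mass eliminated; Gladkov at the actual point
  have hsum := cells_sum_eq_one p A B N
  have hk : m⟦p, A ∩ B ∩ N⟧ = 1 - m⟦p, (A ∪ B)ᶜ⟧ - m⟦p, A \ B⟧ - m⟦p, B \ A⟧ - m⟦p, (A ∩ B) \ N⟧ := by linarith
  have hG0 := gladkov_cells p (h₂.union h₃) (h₁.union h₃) (h₁.union h₂) s1 s2 s3
  rw [hk]
  rw [hk] at hG0
  rw [ho] at hG0 ⊢
  have q0 := prod_oneSub_mem p P0
  have q1 := prod_oneSub_mem p P1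
  have q2 := prod_oneSub_mem p P2
  have hQ : 0 ≤ Q0 * Q1 * Q2 := mul_nonneg (mul_nonneg q0.1 q1.1) q2.1
  -- transfer to the envelope
  have key := maxCells_antitone (o := Q0 * Q1 * Q2) hQ (massAC_nonneg p _) (massAC_nonneg p _) (massAC_nonneg p _)
    hα hβ hd (sub_nonneg.2 hG0)
  -- value at the envelope: outside pays exactly, value = (max(κ'',o) − o)·G'' with G'' = Q(1−Q0)(1−Q1)(1−Q2)
  have hGenv : (1 - Q0 * Q1 * Q2 - (Q0 * Q2 - Q0 * Q1 * Q2) - (Q1 * Q2 - Q0 * Q1 * Q2) - (Q0 * Q1 - Q0 * Q1 * Q2))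
        * (Q0 * Q1 * Q2)
        - ((Q0 * Q2 - Q0 * Q1 * Q2) * (Q1 * Q2 - Q0 * Q1 * Q2) + (Q0 * Q2 - Q0 * Q1 * Q2) * (Q0 * Q1 - Q0 * Q1 * Q2)
            + (Q1 * Q2 - Q0 * Q1 * Q2) * (Q0 * Q1 - Q0 * Q1 * Q2))
        = Q0 * Q1 * Q2 * ((1 - Q0) * (1 - Q1) * (1 - Q2)) := by ring
  have he3env : (Q0 * Q2 - Q0 * Q1 * Q2) * (Q1 * Q2 - Q0 * Q1 * Q2) * (Q0 * Q1 - Q0 * Q1 * Q2)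
        = Q0 * Q1 * Q2 * (Q0 * Q1 * Q2 * ((1 - Q0) * (1 - Q1) * (1 - Q2))) := by ring
  have hGenv0 : 0 ≤ Q0 * Q1 * Q2 * ((1 - Q0) * (1 - Q1) * (1 - Q2)) :=
    mul_nonneg hQ (mul_nonneg (mul_nonneg (sub_nonneg.2 q0.2) (sub_nonneg.2 q1.2)) (sub_nonneg.2 q2.2))
  have hval : 0 ≤ max (1 - Q0 * Q1 * Q2 - (Q0 * Q2 - Q0 * Q1 * Q2) - (Q1 * Q2 - Q0 * Q1 * Q2) - (Q0 * Q1 - Q0 * Q1 * Q2))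
        (Q0 * Q1 * Q2) *
        ((1 - Q0 * Q1 * Q2 - (Q0 * Q2 - Q0 * Q1 * Q2) - (Q1 * Q2 - Q0 * Q1 * Q2) - (Q0 * Q1 - Q0 * Q1 * Q2))
          * (Q0 * Q1 * Q2)
          - ((Q0 * Q2 - Q0 * Q1 * Q2) * (Q1 * Q2 - Q0 * Q1 * Q2) + (Q0 * Q2 - Q0 * Q1 * Q2) * (Q0 * Q1 - Q0 * Q1 * Q2)
              + (Q1 * Q2 - Q0 * Q1 * Q2) * (Q0 * Q1 - Q0 * Q1 * Q2)))
        - (Q0 * Q2 - Q0 * Q1 * Q2) * (Q1 * Q2 - Q0 * Q1 * Q2) * (Q0 * Q1 - Q0 * Q1 * Q2) := by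
    rw [hGenv, he3env]
    have hmo : Q0 * Q1 * Q2 ≤ max (1 - Q0 * Q1 * Q2 - (Q0 * Q2 - Q0 * Q1 * Q2) - (Q1 * Q2 - Q0 * Q1 * Q2)
        - (Q0 * Q1 - Q0 * Q1 * Q2)) (Q0 * Q1 * Q2) := le_max_right _ _
    nlinarith [mul_le_mul_of_nonneg_right hmo hGenv0]
  linarith

/-- **COROLLARY (S₃⁺ on the atom-covering stratum).**  Under the same hypotheses `0 ≤ strongCubicPlus` for the co-sunflower
(since `max(κ,o) ≤ κ + o` and `G ≥ 0`). [this work] -/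
theorem coSunflower_strongCubicPlus_nonneg_of_atomCovering (p : ι → unitInterval) {G₁ G₂ G₃ : Set (Set ι)}
    (h₁ : IsUpperSet G₁) (h₂ : IsUpperSet G₂) (h₃ : IsUpperSet G₃) (hcov : ∀ u : ι, ({u} : Set ι) ∈ G₁ ∪ G₂ ∪ G₃)
    (h0 : (∅ : Set ι) ∉ G₁ ∪ G₂ ∪ G₃) :
    0 ≤ strongCubicPlus p (G₂ ∪ G₃) (G₁ ∪ G₃) (G₁ ∪ G₂) := by
  have hmax := coSunflower_maxSide_nonneg_of_atomCovering p h₁ h₂ h₃ hcov h0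
  obtain ⟨s1, s2, s3⟩ := coSunflower_sandwich G₁ G₂ G₃
  have hG := gladkov_cells p (h₂.union h₃) (h₁.union h₃) (h₁.union h₂) s1 s2 s3
  have hκ := massAC_nonneg p ((G₂ ∪ G₃) ∩ (G₁ ∪ G₃) ∩ (G₁ ∪ G₂))
  have ho := massAC_nonneg p ((G₂ ∪ G₃) ∪ (G₁ ∪ G₃))ᶜ
  have hle : max (m⟦p, (G₂ ∪ G₃) ∩ (G₁ ∪ G₃) ∩ (G₁ ∪ G₂)⟧) (m⟦p, ((G₂ ∪ G₃) ∪ (G₁ ∪ G₃))ᶜ⟧)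
      ≤ m⟦p, (G₂ ∪ G₃) ∩ (G₁ ∪ G₃) ∩ (G₁ ∪ G₂)⟧ + m⟦p, ((G₂ ∪ G₃) ∪ (G₁ ∪ G₃))ᶜ⟧ :=
    max_le (by linarith) (by linarith)
  have step := mul_le_mul_of_nonneg_right hle (sub_nonneg.2 hG)
  simp only [strongCubicPlus]
  linarith

/-- **COROLLARY (S₃ on the atom-covering stratum)**: `0 ≤ strongCubic = κo − e₂ − e₃` for the co-sunflower. [this work] -/
theorem coSunflower_strongCubic_nonneg_of_atomCovering (p : ι → unitInterval) {G₁ G₂ G₃ : Set (Set ι)}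
    (h₁ : IsUpperSet G₁) (h₂ : IsUpperSet G₂) (h₃ : IsUpperSet G₃) (hcov : ∀ u : ι, ({u} : Set ι) ∈ G₁ ∪ G₂ ∪ G₃)
    (h0 : (∅ : Set ι) ∉ G₁ ∪ G₂ ∪ G₃) :
    0 ≤ strongCubic p (G₂ ∪ G₃) (G₁ ∪ G₃) (G₁ ∪ G₂) := by
  obtain ⟨s1, s2, s3⟩ := coSunflower_sandwich G₁ G₂ G₃
  exact le_trans (coSunflower_strongCubicPlus_nonneg_of_atomCovering p h₁ h₂ h₃ hcov h0)
    (strongCubicPlus_le_strongCubic p (h₂.union h₃) (h₁.union h₃) (h₁.union h₂) s1 s2 s3)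

end SahiDeepCore

end Summit.CriticalPhenomena.PercolationContinuityZ3.Theorems
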